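import Summits.QuantumFields.YangMills.Theorems.LangevinControlUVFemtoCurvatureSkewnessCRatioTransportDefsG
import Summits.QuantumFields.YangMills.Theorems.LangevinControlUVFemtoCurvatureSkewnessCQualitativeDescent

/-!
# Crux `FemtoCurvatureSkewnessC` (stmt-QuantumFields-16205) — line `ratio-transport` (slug `Sketch`): the lead's skeleton, v5

Lead `prover-line-stmt-QuantumFields-16205-c3-0` (line lead, cycle 4, 2026-08-16), reshaping v4.2 of lead `…-c2-0` (v4.1: `…-c1-0`;
v3: `…-16205-0`; planner's `Sketch_ideator1.lean`, idea card `Cruxes/FemtoCurvatureSkewnessC/Ideas/ratio-transport.md`).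

ONE STUB.  Reading the landed rate-free descent (`ratioFloor_of_twoEndedQ`, p128513) once more: v4.2's four stubs — E_c `CutoffEngineTE`
(two-ended cutoff transport = Cauchy along RG chains), E_v `VolumeEngineQ`, E_s `SeparationEngineQ` (moduli of continuity in `log L`,
`log n`), A `Anchors` (fixed-torus `β → ∞` asymptotics WITH VALUE) — are consumed ONLY to produce `RatioFloor r a₀` at the hypothesis map,
after which the line's landed back half (`signedRigidity_of_ratioFloor` p123064 → `skewnessPackage_of_signedRigidity` →
`femtoCurvatureSkewnessC_iff`) closes the crux with output map `a₀`.  Skeleton v5 registers that target itself as the single stub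
`stub_ratioFloorC : Sig.stub_ratioFloorC` (`= RatioFloorC`, vocabulary (G) `…CRatioTransportDefsG.lean`): MONOTONE (the four v4.2 stubs
imply it, `ratioFloorC_of_enginesQ`), and — the cycle-4 DOMINANCE finding — implied DIRECTLY by ONE fixed-relative-error statement,
`PressureDominanceC` (tree dominance of the marked-coupling pressure derivatives on the femto boxes of some continuous package map; the
sibling line `coupling-cubic-response`'s engine E in C-form): `ratioFloorC_of_pressureDominanceC` (no transport, no anchors, no continuum
limit, no toron semiclassics), indeed `femtoCurvatureSkewnessC_of_pressureDominanceC`.  All bridges: `…CDominanceBridges.lean` (this lead).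

Verdict carried by this skeleton: the crux has no known decomposition into independently provable pieces — every line funnels into one
asymptotic-freedom engine statement with three plaquette insertions; the economical one to PROMOTE is `PressureDominanceC` (engine form;
or `RatioFloorC`, corollary form = this stub), which any such engine outputs before the convergence statements v4.2 asked for.
History v1 → v4.2 (compositions all landed): `Lines/Sketch.md`.

Layout: § Stub (`theorem stub_ratioFloorC : Sig.stub_ratioFloorC`, the ONLY `sorry`) · § Assembly (`FemtoCurvatureSkewnessC_of` over it,
sorry-free, concludes the route decl by name; `FemtoCurvatureSkewnessC_skeleton`).
-/

set_option autoImplicit false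

noncomputable section

namespace Summit.QuantumFields.YangMills.Cruxes.FemtoCurvatureSkewnessC.RatioTransport

open MeasureTheory
open Literature.MathematicalPhysics.QuantumFieldTheory
open Summit.QuantumFields.YangMills.Theses.LangevinControlUV (FemtoCurvatureSkewnessC)
open Summit.QuantumFields.YangMills.Theorems.FemtoCurvatureSkewness (femtoCurvatureSkewnessC_iff)
open Summit.QuantumFields.YangMills.Cruxes.FemtoCurvatureSkewness.CouplingCubicResponse (skewnessPackage_of_signedRigidity)

/-! ## § Stub — the ONLY `sorry` of the file -/

/-- **Stub `stub_ratioFloorC` — the line's target as ONE statement (crux-sized):** `RatioFloorC` — for compact simple `G`, any `r` and any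
CONTINUOUS map `a₀` carrying the two-point package, the tree-normalised skewness ratio `u = κ₃·G_a/(Cov^{3/2}·G_d)` is bounded below by
some `u₁ > 0` on the femto boxes `β ≥ β₁`, `L·a₀(β) ≤ ℓ₁`, `1 ≤ n ≤ L/8` (tree value `2^{3/2}(dim)^{-1/2}` exactly; MC SU(2) `L = 8`,
`n = 1`: `u ≈ 1.56` vs tree `1.63`).  Sufficient: `PressureDominanceC` (`ratioFloorC_of_pressureDominanceC`) or v4.2's four stubs
(`ratioFloorC_of_enginesQ`).  No Literature fact proves it (it is rigorous asymptotic freedom for a plaquette three-point function). -/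
theorem stub_ratioFloorC : Sig.stub_ratioFloorC := by
  sorry

/-! ## § Assembly — sorry-free; concludes the route decl BY NAME -/

/-- **The line concludes the served crux BY NAME** from the single stub — output map = the hypothesis map `a₀` (continuous and
package by hypothesis); floor ⇒ signed rigidity by `a₀`'s OWN package (`signedRigidity_of_ratioFloor`, p123064) ⇒ skewness package
(`skewnessPackage_of_signedRigidity`) ⇒ the crux (`femtoCurvatureSkewnessC_iff`, `Iff.rfl`).  (Verbatim `femtoCurvatureSkewnessC_of_ratioFloorC` of
the bridges file `…CDominanceBridges.lean`, inlined so that the skeleton depends on the vocabulary (G) and the landed v4.2 modules only.) -/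
theorem FemtoCurvatureSkewnessC_of (hF : Sig.stub_ratioFloorC) : FemtoCurvatureSkewnessC := by
  rw [femtoCurvatureSkewnessC_iff]
  intro G _ _ _ _ hG
  letI : MeasurableSpace G := borel G
  haveI : BorelSpace G := ⟨rfl⟩
  intro r hex
  obtain ⟨a₀, ha₀, hP₀⟩ := hex
  exact ⟨a₀, ha₀, hP₀, skewnessPackage_of_signedRigidity r hP₀
    (signedRigidity_of_ratioFloor r hP₀ (hF G hG r a₀ ha₀ hP₀))⟩

/-- The skeleton: the crux modulo the single registered stub. -/
theorem FemtoCurvatureSkewnessC_skeleton : FemtoCurvatureSkewnessC :=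
  FemtoCurvatureSkewnessC_of stub_ratioFloorC

end Summit.QuantumFields.YangMills.Cruxes.FemtoCurvatureSkewnessC.RatioTransport

end
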